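import Literature.Computability.QuantumComplexity.DyadicPhaseThresholds
import Literature.Computability.Complexity.CodeFPArith
import HarnessLib

/-!
# The dyadic phase thresholds `cosThr`, `sinThr` in polynomial time

Topic `Literature/Computability/QuantumComplexity`; a companion of `DyadicPhaseThresholds.lean` for the UNIFORMITY of
the Fourier stage of Regev's sampler ([Regev2009, Lemma 3.14, proof]; stage S4): the controlled-phase program of the
pair `(j, l)` is `SLP.qftPhaseB k (cosThr m k) (sinThr m k)`, `m = l − j + 1`, and a uniform machine printing the
stage must compute the two thresholds. They are polynomial time in the UNARY `m, k` (typed `CodeFP`,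
`Complexity/CodeFP.lean`): `cosThr m k = min 2ᵏ (2^{k−1} + cosDyadic m (k−1))⁺` with `TrigDyadic.codeFP_cosDyadic`
([Ko1991, §2]; `Complexity/TrigDyadicFP.lean`), binary powers `natPow`, integer addition and positive part.

* `SLP.codeFP_pow2_un` — `1ᵏ ↦ bin 2ᵏ`; `SLP.codeFP_predUn` — `1ᵏ ↦ 1^{k−1}`;
* **`SLP.codeFP_cosThr`**, **`SLP.codeFP_sinThr`** — `(1ᵐ, 1ᵏ) ↦ bin (cosThr m k)`, `bin (sinThr m k)`.

Everything is proved; no named fact is introduced.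

## References

* O. Regev, J. ACM 56(6) (2009), Lemma 3.14 (proof) [Regev2009].
* K.-I. Ko, *Complexity Theory of Real Functions*, Birkhäuser 1991, §2 [Ko1991].
* M. A. Nielsen, I. L. Chuang, *Quantum Computation and Quantum Information*, CUP 2010, §5.1 [NielsenChuang2010].
-/

noncomputable section

namespace Literature.Computability.QuantumComplexity

open _root_.Computability Cryptography Complexity Complexity.CodeFP

namespace SLP

/-- `1ᵏ ↦ bin 2ᵏ`. [folklore] -/
theorem codeFP_pow2_un : CodeFP unE natE (fun k => 2 ^ k) := (natPow.comp ((const unE 2).pair (CodeFP.id unE)) :)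

/-- `1ᵏ ↦ 1^{k-1}`. [folklore] -/
theorem codeFP_predUn : CodeFP unE unE (fun k => k - 1) :=
  (unOfNatMin.comp ((CodeFP.id unE).pair (natSub.comp (natOfUn.pair (const unE 1))))).congr fun k => by
    show min (id k - 1) (id k) = k - 1; simp

/-- The clamped threshold `(d : ℤ) ↦ min 2ᵏ (2^{k-1} + d)⁺` on codes (the power cast from `ℕ`), for `d` computed from
`(1ᵐ, 1ᵏ)`. [folklore] -/
theorem codeFP_thrOf {d : ℕ × ℕ → ℤ} (hd : CodeFP (pairE unE unE) intE d) :
    CodeFP (pairE unE unE) natE (fun p => min (2 ^ p.2) ((((2 ^ (p.2 - 1) : ℕ) : ℤ)) + d p).toNat) := by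
  have hk : CodeFP (pairE unE unE) unE (fun p => p.2) := snd _ _
  have h2k : CodeFP (pairE unE unE) natE (fun p => 2 ^ p.2) := codeFP_pow2_un.comp hk
  have h2k1 : CodeFP (pairE unE unE) intE (fun p => (((2 ^ (p.2 - 1) : ℕ) : ℤ))) :=
    intOfNat.comp (codeFP_pow2_un.comp (codeFP_predUn.comp hk))
  have hsum : CodeFP (pairE unE unE) natE (fun p => ((((2 ^ (p.2 - 1) : ℕ) : ℤ)) + d p).toNat) :=
    (intToNat.comp (intAdd.comp (h2k1.pair hd)) :)
  exact (natMin.comp (h2k.pair hsum) :)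

/-- **`(1ᵐ, 1ᵏ) ↦ bin (cosThr m k)`.** [cite: Ko1991, §2] [cite: NielsenChuang2010, §5.1] -/
theorem codeFP_cosThr : CodeFP (pairE unE unE) natE (fun p => cosThr p.1 p.2) :=
  (codeFP_thrOf (TrigDyadic.codeFP_cosDyadic.comp ((fst _ _).pair (codeFP_predUn.comp (snd _ _)))) :).congr
    fun p => by rw [cosThr, Nat.cast_pow, Nat.cast_ofNat]

/-- **`(1ᵐ, 1ᵏ) ↦ bin (sinThr m k)`.** [cite: Ko1991, §2] [cite: NielsenChuang2010, §5.1] -/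
theorem codeFP_sinThr : CodeFP (pairE unE unE) natE (fun p => sinThr p.1 p.2) :=
  (codeFP_thrOf (TrigDyadic.codeFP_sinDyadic.comp ((fst _ _).pair (codeFP_predUn.comp (snd _ _)))) :).congr
    fun p => by rw [sinThr, Nat.cast_pow, Nat.cast_ofNat]

end SLP

end Literature.Computability.QuantumComplexity

end
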